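import Summits.CriticalPhenomena.PercolationContinuityZ3.Theorems.Transplant.BoxProdZ2AllFibres
import Summits.CriticalPhenomena.PercolationContinuityZ3.Theorems.Transplant.BoxProdZ2ZdInstance
import Mathlib.Combinatorics.SimpleGraph.Prod
import HarnessLib

/-!
# Benjamini–Schramm's Conjecture 4 for `X □ ℤ^d`, EVERY `d ≥ 2`, every connected locally finite quasi-transitive `X` (finite or infinite):
# `θ_{X □ ℤ^d}(v, p_c(X □ ℤ^d)) = 0` at every vertex — `X □ ℤ^d ≅ (X □ ℤ^{d-2}) □ ℤ²` and the cardinality-free product theorem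

builds on p205010 (kernel theorem, internal audit signed; external expert review pending).
Status sentence (coordinator 2026-08-20T04:30Z): "θ(p_c) = 0 on ℤ^d, all d ≥ 2 — kernel-verified (Lean 4/Mathlib, standard axioms); internal adversarial
audit SIGNED 2026-08-20 04:29Z; external expert review pending."
Lane `prim-bschramm-*`, seat `prim-bschramm-p2` (gen 3; class C1b / D⁺ of P2-LATTICES §10); helper file (`--supports stmt-CriticalPhenomena-4575`).

The closed product node is stated for the planar factor `ℤ²` (`bsConj4_boxProdZ2_holds`, p228654; cardinality-free form
`BoxProdZ2.bsConj4_boxProdZ2_all'`, p229671).  Since `X □ ℤ^{a+2} ≅ (X □ ℤ^a) □ ℤ²` (Mathlib `boxProdAssoc` and the tree's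
`zdGraphProdIso a 2 : ℤ^a □ ℤ² ≃g ℤ^{a+2}`) and `X □ ℤ^a` is again connected, locally finite and quasi-transitive, the theorem holds with ANY
`ℤ^d`, `d ≥ 2`, as the abelian factor:
* **`bsConj4_boxProdZd_all (hd : 2 ≤ d) (v) : theta (X □ zdGraph d) v (criticalProbIOf (X □ zdGraph d) v) = 0`** for every connected, locally
  finite, quasi-transitive `X` and EVERY vertex `v` (so: `Cay(Γ) × ℤ^d` for every finitely generated group `Γ` and every `d ≥ 2`; `F × ℤ^d` for
  finite `F`; …);
* `boxProdZd_noInfiniteCluster_at_ownCriticalProb` — a.s. no infinite cluster anywhere in `X □ ℤ^d` at its critical point (countable union).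
`d = 0, 1` are excluded (there `X □ ℤ^d` is `X` resp. `X × ℤ`, where `θ(p_c) = 0` is open in general / false for finite `X`).
[cite: BenjaminiSchramm1996, Conj. 4] [cite: KozmaNitzan2024, §1 p. 2 (approach 1); §4 Theorem 6] [cite: MartineauPanagiotis2025, Prop. 1.10]
-/

noncomputable section

open MeasureTheory

namespace Summit.CriticalPhenomena.PercolationContinuityZ3.Theorems

namespace Transplant

namespace BoxProdZ2

open Literature.Probability.Percolation Literature.Probability.LatticeModels SimpleGraph
open Literature.Barriers.CriticalPhenomena (IsQuasiTransitive zdGraph_connected zdGraph_isQuasiTransitive countable_of_connected_of_locallyFinite)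

variable {W : Type} (X : SimpleGraph W)

/-- **BENJAMINI–SCHRAMM'S CONJECTURE 4 FOR `X □ ℤ^d`, every `d ≥ 2`, at every vertex** — `X` connected, locally finite, quasi-transitive,
of any cardinality: `θ_{X □ ℤ^d}(v, p_c(X □ ℤ^d, v)) = 0`.  From `BoxProdZ2.bsConj4_boxProdZ2_all'` at `X □ ℤ^{d-2}` transported along
`(X □ ℤ^{d-2}) □ ℤ² ≃g X □ ℤ^d` (`boxProdAssoc`, `zdGraphProdIso`) — builds on p205010 (kernel theorem, internal audit signed; external expert review pending).
[cite: BenjaminiSchramm1996, Conj. 4] [cite: KozmaNitzan2024, §1 p. 2 (approach 1)] -/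
theorem bsConj4_boxProdZd_all [X.LocallyFinite] (hc : X.Connected) (hqt : IsQuasiTransitive X) {d : ℕ} (hd : 2 ≤ d)
    (v : W × Site d) : theta (X □ zdGraph d) v (criticalProbIOf (X □ zdGraph d) v) = 0 := by
  classical
  obtain ⟨a, rfl⟩ : ∃ a, d = a + 2 := ⟨d - 2, by omega⟩
  -- the factor `X □ ℤ^a`
  have hc' : (X □ zdGraph a).Connected := hc.boxProd (zdGraph_connected a)
  have hq' : IsQuasiTransitive (X □ zdGraph a) := isQuasiTransitive_boxProd hqt (zdGraph_isQuasiTransitive a)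
  haveI : Countable (W × Site (a + 2)) :=
    countable_of_connected_of_locallyFinite (X □ zdGraph (a + 2)) (hc.boxProd (zdGraph_connected (a + 2))) v
  haveI : Countable ((W × Site a) × Site 2) :=
    countable_of_connected_of_locallyFinite ((X □ zdGraph a) □ zdGraph 2) (hc'.boxProd (zdGraph_connected 2)) ((v.1, 0), 0)
  -- `(X □ ℤ^a) □ ℤ² ≃g X □ ℤ^{a+2}` and a preimage of `v`
  set e : ((X □ zdGraph a) □ zdGraph 2) ≃g (X □ zdGraph (a + 2)) :=
    (SimpleGraph.boxProdAssoc (G := X) (H := zdGraph a) (zdGraph 2)).trans (boxProdIso (RelIso.refl X.Adj) (zdGraphProdIso a 2)) with he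
  obtain ⟨u, hu⟩ := e.surjective v
  have key := bsConj4_boxProdZ2_all' (X □ zdGraph a) hc' hq' u
  have hθ : ∀ p, theta (X □ zdGraph (a + 2)) (e u) p = theta ((X □ zdGraph a) □ zdGraph 2) u p := fun p => theta_iso e u p
  have hpc : criticalProbIOf ((X □ zdGraph a) □ zdGraph 2) u = criticalProbIOf (X □ zdGraph (a + 2)) (e u) :=
    Subtype.ext (criticalProb_iso e u).symm
  rw [← hu, hθ, ← hpc]
  exact key

/-- **A.s. no infinite cluster anywhere in `X □ ℤ^d` at its own critical point** (`d ≥ 2`; `X` connected, locally finite, quasi-transitive, any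
cardinality; the root `v₀` only names the critical point, which is the same at every vertex) — builds on p205010 (kernel theorem, internal audit
signed; external expert review pending). [cite: BenjaminiSchramm1996, Conj. 4] -/
theorem boxProdZd_noInfiniteCluster_at_ownCriticalProb [X.LocallyFinite] (hc : X.Connected) (hqt : IsQuasiTransitive X) {d : ℕ}
    (hd : 2 ≤ d) (v₀ : W × Site d) :
    (bondPercolation (X □ zdGraph d) (criticalProbIOf (X □ zdGraph d) v₀)).real {ω | ∃ y, ω ∈ percolatesAt y} = 0 := by
  have hcd : (X □ zdGraph d).Connected := hc.boxProd (zdGraph_connected d)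
  haveI : Countable (W × Site d) := countable_of_connected_of_locallyFinite (X □ zdGraph d) hcd v₀
  have hy : ∀ y : W × Site d, theta (X □ zdGraph d) y (criticalProbIOf (X □ zdGraph d) v₀) = 0 := by
    intro y
    have hI : criticalProbIOf (X □ zdGraph d) y = criticalProbIOf (X □ zdGraph d) v₀ :=
      Subtype.ext (criticalProb_eq_of_reachable _ (hcd.preconnected y v₀))
    rw [← hI]
    exact bsConj4_boxProdZd_all X hc hqt hd y
  have hset : {ω : BondConfig (W × Site d) | ∃ y, ω ∈ percolatesAt y} = ⋃ y, percolatesAt y := by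
    ext ω; simp
  rw [measureReal_def, hset, ENNReal.toReal_eq_zero_iff]
  left
  refine (measure_iUnion_null_iff).2 fun y => ?_
  have h := hy y
  rw [theta, measureReal_def, ENNReal.toReal_eq_zero_iff] at h
  exact h.resolve_right (measure_ne_top _ _)

end BoxProdZ2

end Transplant

end Summit.CriticalPhenomena.PercolationContinuityZ3.Theorems

end
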